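import Summits.NavierStokesRegularity.NavierStokesRegularity.Theorems.RellichScarScarRigidityPaintedLadderKernelTaylor
import Summits.NavierStokesRegularity.NavierStokesRegularity.Theorems.RellichScarScarRigidityCoulombDerivative
import Summits.NavierStokesRegularity.NavierStokesRegularity.Theorems.RellichScarScarRigidityVorticityDefect
import HarnessLib

/-!
# `ScarRigidity`, line `moment-conditioned-rellich` — stub `stub_paintedLadderHigher` (PL≥2), part 5:
# the multipole expansion of the Newtonian potential of a decaying density, to every order

Crux stmt-NavierStokesRegularity-11717 (route RellichScar), helper file (`--supports`) for the registered stub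
`stub_paintedLadderHigher`.  Pure harmonic analysis on `ℝ³`: for a continuous density with
`|h(y)| ≤ B/(‖y‖+a)^{M+5}` (`a > 0`) and a point `x` with `‖x‖ ≥ a`, the Newtonian potential
`u(x) = ∫ Γ(x − y) h(y) dy` (`Γ = newtonKernel = −1/(4π|z|)`) is its multipole series to order `M` up to a remainder
of the next order (`newtonPotential_multipole_expansion`):

  `|u(x) − Σ_{m ≤ M} (−1)ᵐ/m! ∫ DᵐΓ(x)(y,…,y) h(y) dy| ≤ C_M B/(a ‖x‖^{M+2})`,

all integrals converging absolutely (Stein, *Singular integrals* III §3.1; the case `M = 0` with first moment is the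
tree's `NewtonPotentialFarField`).  Proof: with `T(y) = Σ_{m ≤ M} (−1)ᵐ/m! DᵐΓ(x)(y,…,y)` the left side is
`|∫ (Γ(x − y) − T(y)) h(y) dy|`; on `‖y‖ ≤ ‖x‖/2` the Taylor remainder of part 4 gives
`|Γ(x − y) − T(y)| |h(y)| ≤ C_T B ‖x‖^{−(M+2)} (‖y‖+a)⁻⁴`; on `‖y‖ > ‖x‖/2` the crude bounds `|Γ(x − y)|` and
`|T(y)| ≤ Σ K_m‖y‖ᵐ/(m!‖x‖^{m+1})` against the decay of `h` give
`2^{M+2} B ‖x‖^{−(M+2)} |Γ(x − y)|(‖y‖+a)⁻³ + S B ‖x‖^{−(M+2)} (‖y‖+a)⁻⁴`; and `∫ (‖y‖+a)⁻⁴ = c₄/a`,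
`∫ |Γ(x − y)|(‖y‖+a)⁻³ dy ≤ K a^{−1/4}‖x‖^{−3/4} ≤ K/a` (lead 0's Coulomb toolkit).
-/

noncomputable section

open Set Filter Function MeasureTheory Metric TopologicalSpace
open scoped Topology ContDiff
open Literature.Analysis.FluidPDE

set_option linter.dupNamespace false -- D-0017: `Summit.<S>.<S>.…` repeats the summit name by design

namespace Summit.NavierStokesRegularity.NavierStokesRegularity.Theorems.RellichScarScarRigidity

/-! ### Elementary weights -/

/-- `‖y‖^{M+1}/(‖y‖+a)^{M+5} ≤ (‖y‖+a)⁻⁴` (`a ≥ 0`, `‖y‖ + a > 0`). [folklore] -/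
theorem pow_div_norm_add_pow_le {r a : ℝ} (hr : 0 ≤ r) (hρ : 0 < r + a) (ha : 0 ≤ a) (M : ℕ) :
    r ^ (M + 1) / (r + a) ^ (M + 5) ≤ ((r + a) ^ 4)⁻¹ := by
  rw [show M + 5 = (M + 1) + 4 by ring, pow_add (r + a) (M + 1) 4, div_mul_eq_div_div, div_le_iff₀ (pow_pos hρ 4),
    inv_mul_cancel₀ (pow_pos hρ 4).ne']
  exact (div_le_one (pow_pos hρ _)).2 (pow_le_pow_left₀ hr (by linarith) _)

/-- Far from the origin the tail of the weight is paid by the radius: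
`‖y‖ᵐ/(‖y‖+a)^{m+j+5} ≤ (R^{j+1})⁻¹ (‖y‖+a)⁻⁴` for `R ≤ ‖y‖ + a`, `R > 0`. [folklore] -/
theorem pow_div_norm_add_pow_le_far {r a R : ℝ} (hr : 0 ≤ r) (ha : 0 ≤ a) (hR : 0 < R) (hRr : R ≤ r + a) (m j : ℕ) :
    r ^ m / (r + a) ^ (m + j + 5) ≤ (R ^ (j + 1))⁻¹ * ((r + a) ^ 4)⁻¹ := by
  have hρ : 0 < r + a := hR.trans_le hRr
  have h1 : r ^ m / (r + a) ^ m ≤ 1 := (div_le_one (pow_pos hρ _)).2 (pow_le_pow_left₀ hr (by linarith) _)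
  have h2 : ((r + a) ^ (j + 1))⁻¹ ≤ (R ^ (j + 1))⁻¹ := inv_anti₀ (pow_pos hR _) (pow_le_pow_left₀ hR.le hRr _)
  calc r ^ m / (r + a) ^ (m + j + 5) = r ^ m / (r + a) ^ m * (((r + a) ^ (j + 1))⁻¹ * ((r + a) ^ 4)⁻¹) := by
        rw [show m + j + 5 = m + ((j + 1) + 4) by ring, pow_add, pow_add]
        field_simp
    _ ≤ 1 * ((R ^ (j + 1))⁻¹ * ((r + a) ^ 4)⁻¹) :=
        mul_le_mul h1 (mul_le_mul_of_nonneg_right h2 (by positivity)) (by positivity) zero_le_one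
    _ = (R ^ (j + 1))⁻¹ * ((r + a) ^ 4)⁻¹ := one_mul _

/-- `1/(‖y‖+a)^{M+5} ≤ (R^{M+2})⁻¹ (‖y‖+a)⁻³` for `R ≤ ‖y‖ + a`, `R > 0`. [folklore] -/
theorem inv_norm_add_pow_le_far {ρ R : ℝ} (hR : 0 < R) (hRρ : R ≤ ρ) (M : ℕ) :
    (ρ ^ (M + 5))⁻¹ ≤ (R ^ (M + 2))⁻¹ * (ρ ^ 3)⁻¹ := by
  have hρ : 0 < ρ := hR.trans_le hRρ
  rw [show M + 5 = (M + 2) + 3 by ring, pow_add, mul_inv]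
  exact mul_le_mul_of_nonneg_right (inv_anti₀ (pow_pos hR _) (pow_le_pow_left₀ hR.le hRρ _)) (by positivity)

/-- `a^{−1/4} ‖x‖^{−3/4} ≤ a⁻¹` for `0 < a ≤ ‖x‖`. [folklore] -/
theorem rpow_quarter_mul_rpow_le {a r : ℝ} (ha : 0 < a) (har : a ≤ r) :
    a ^ (-(1 / 4 : ℝ)) * r ^ (-(3 / 4 : ℝ)) ≤ a⁻¹ := by
  have hr : 0 < r := ha.trans_le har
  have h1 : r ^ (-(3 / 4 : ℝ)) ≤ a ^ (-(3 / 4 : ℝ)) :=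
    Real.rpow_le_rpow_of_nonpos ha har (by norm_num)
  calc a ^ (-(1 / 4 : ℝ)) * r ^ (-(3 / 4 : ℝ)) ≤ a ^ (-(1 / 4 : ℝ)) * a ^ (-(3 / 4 : ℝ)) :=
        mul_le_mul_of_nonneg_left h1 (by positivity)
    _ = a⁻¹ := by
        rw [← Real.rpow_add ha, show (-(1 / 4 : ℝ)) + -(3 / 4 : ℝ) = -1 by norm_num, Real.rpow_neg_one]

/-! ### The Taylor polynomial of the kernel: size and integrability against the density -/

/-- `|DᵐΓ(x)(y,…,y)| ≤ ‖DᵐΓ(x)‖ ‖y‖ᵐ`. [folklore] -/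
theorem abs_iteratedFDeriv_newtonKernel_apply_le (m : ℕ) (x y : EuclideanSpace ℝ (Fin 3)) :
    |iteratedFDeriv ℝ m newtonKernel x (fun _ => y)| ≤ ‖iteratedFDeriv ℝ m newtonKernel x‖ * ‖y‖ ^ m := by
  rw [← Real.norm_eq_abs]
  refine (ContinuousMultilinearMap.le_opNorm _ _).trans (le_of_eq ?_)
  rw [Fin.prod_const]

/-- The terms of the multipole series converge absolutely: `y ↦ DᵐΓ(x)(y,…,y) h(y)` is integrable for `m ≤ M + 1`
when `|h(y)| ≤ B/(‖y‖+a)^{M+5}`. [folklore] -/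
theorem integrable_iteratedFDeriv_newtonKernel_apply_mul {h : EuclideanSpace ℝ (Fin 3) → ℝ} (hh : Continuous h)
    {a B : ℝ} (ha : 0 < a) {M : ℕ} (hb : ∀ y, |h y| ≤ B / (‖y‖ + a) ^ (M + 5)) (x : EuclideanSpace ℝ (Fin 3))
    {m : ℕ} (hm : m ≤ M + 1) :
    Integrable (fun y => iteratedFDeriv ℝ m newtonKernel x (fun _ => y) * h y) volume := by
  obtain ⟨j, hj⟩ := Nat.exists_eq_add_of_le hm
  have hB : 0 ≤ B := by
    by_contra hneg
    have h0 := (abs_nonneg _).trans (hb 0)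
    rw [norm_zero, zero_add] at h0
    linarith [div_neg_of_neg_of_pos (not_le.1 hneg) (pow_pos ha (M + 5))]
  have hc : Continuous fun y : EuclideanSpace ℝ (Fin 3) => iteratedFDeriv ℝ m newtonKernel x (fun _ => y) * h y :=
    ((iteratedFDeriv ℝ m newtonKernel x).cont.comp (continuous_pi fun _ => continuous_id)).mul hh
  refine integrable_of_norm_le_apexWeight hc.aestronglyMeasurable ha (p := j + 4) (by omega)
    (C := ‖iteratedFDeriv ℝ m newtonKernel x‖ * B) fun y => ?_
  have hρ : 0 < ‖y‖ + a := by positivity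
  rw [norm_mul, Real.norm_eq_abs, Real.norm_eq_abs]
  have h1 := abs_iteratedFDeriv_newtonKernel_apply_le m x y
  have h2 := hb y
  have hw : ‖y‖ ^ m / (‖y‖ + a) ^ (M + 5) ≤ ((‖y‖ + a) ^ (j + 4))⁻¹ := by
    rw [show M + 5 = m + (j + 4) by omega, pow_add, div_mul_eq_div_div, div_le_iff₀ (pow_pos hρ _),
      inv_mul_cancel₀ (pow_pos hρ _).ne']
    exact (div_le_one (pow_pos hρ _)).2 (pow_le_pow_left₀ (norm_nonneg _) (by linarith) _)
  calc |iteratedFDeriv ℝ m newtonKernel x (fun _ => y)| * |h y|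
      ≤ (‖iteratedFDeriv ℝ m newtonKernel x‖ * ‖y‖ ^ m) * (B / (‖y‖ + a) ^ (M + 5)) :=
        mul_le_mul h1 h2 (abs_nonneg _) (by positivity)
    _ = ‖iteratedFDeriv ℝ m newtonKernel x‖ * B * (‖y‖ ^ m / (‖y‖ + a) ^ (M + 5)) := by ring
    _ ≤ ‖iteratedFDeriv ℝ m newtonKernel x‖ * B * ((‖y‖ + a) ^ (j + 4))⁻¹ :=
        mul_le_mul_of_nonneg_left hw (by positivity)
    _ = ‖iteratedFDeriv ℝ m newtonKernel x‖ * B / (‖y‖ + a) ^ (j + 4) := by rw [div_eq_mul_inv]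

/-- The potential converges absolutely: `y ↦ Γ(x − y) h(y)` is integrable for `x ≠ 0` when
`|h(y)| ≤ B/(‖y‖+a)^{M+5}` (`|h| ≤ B a^{−(M+2)} (‖y‖+a)⁻³` against the Coulomb majorant). [folklore] -/
theorem integrable_newtonKernel_mul_of_apexWeight {h : EuclideanSpace ℝ (Fin 3) → ℝ} (hh : Continuous h)
    {a B : ℝ} (ha : 0 < a) {M : ℕ} (hb : ∀ y, |h y| ≤ B / (‖y‖ + a) ^ (M + 5)) {x : EuclideanSpace ℝ (Fin 3)}
    (hx : x ≠ 0) : Integrable (fun y => newtonKernel (x - y) * h y) volume := by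
  obtain ⟨K, -, hK⟩ := exists_integral_abs_newtonKernel_mul_weight_le
  obtain ⟨hint, -⟩ := hK a ha x hx
  have hB : 0 ≤ B := by
    by_contra hneg
    have h0 := (abs_nonneg _).trans (hb 0)
    rw [norm_zero, zero_add] at h0
    linarith [div_neg_of_neg_of_pos (not_le.1 hneg) (pow_pos ha (M + 5))]
  refine (hint.const_mul (B * (a ^ (M + 2))⁻¹)).mono'
    ((measurable_newtonKernel.comp (measurable_const.sub measurable_id)).aestronglyMeasurable.mul
      hh.aestronglyMeasurable) (Eventually.of_forall fun y => ?_)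
  have hρ : 0 < ‖y‖ + a := by positivity
  rw [norm_mul, Real.norm_eq_abs, Real.norm_eq_abs]
  have hw : ((‖y‖ + a) ^ (M + 5))⁻¹ ≤ (a ^ (M + 2))⁻¹ * ((‖y‖ + a) ^ 3)⁻¹ :=
    inv_norm_add_pow_le_far ha (by linarith [norm_nonneg y]) M
  calc |newtonKernel (x - y)| * |h y| ≤ |newtonKernel (x - y)| * (B / (‖y‖ + a) ^ (M + 5)) :=
        mul_le_mul_of_nonneg_left (hb y) (abs_nonneg _)
    _ = |newtonKernel (x - y)| * B * ((‖y‖ + a) ^ (M + 5))⁻¹ := by rw [div_eq_mul_inv]; ring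
    _ ≤ |newtonKernel (x - y)| * B * ((a ^ (M + 2))⁻¹ * ((‖y‖ + a) ^ 3)⁻¹) :=
        mul_le_mul_of_nonneg_left hw (by positivity)
    _ = B * (a ^ (M + 2))⁻¹ * (|newtonKernel (x - y)| * ((‖y‖ + a) ^ 3)⁻¹) := by ring

/-! ### The multipole expansion -/

/-- **The multipole expansion of the Newtonian potential of a decaying density, to every order** (Stein, *Singular
integrals* III §3.1).  For every `M` there is `C` such that: for every continuous `h` on `ℝ³` with
`|h(y)| ≤ B/(‖y‖+a)^{M+5}` (`a > 0`, `B ≥ 0`) and every `x` with `‖x‖ ≥ a`, all the integrals below converge absolutely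
and `|∫ Γ(x − y) h(y) dy − Σ_{m ≤ M} (−1)ᵐ/m! ∫ DᵐΓ(x)(y,…,y) h(y) dy| ≤ C B/(a ‖x‖^{M+2})`. [folklore] -/
theorem newtonPotential_multipole_expansion (M : ℕ) :
    ∃ C : ℝ, 0 ≤ C ∧ ∀ (h : EuclideanSpace ℝ (Fin 3) → ℝ), Continuous h → ∀ (a B : ℝ), 0 < a → 0 ≤ B →
      (∀ y, |h y| ≤ B / (‖y‖ + a) ^ (M + 5)) → ∀ x : EuclideanSpace ℝ (Fin 3), a ≤ ‖x‖ →
        Integrable (fun y => newtonKernel (x - y) * h y) volume ∧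
        (∀ m ≤ M + 1, Integrable (fun y => iteratedFDeriv ℝ m newtonKernel x (fun _ => y) * h y) volume) ∧
        |(∫ y, newtonKernel (x - y) * h y) -
            ∑ m ∈ Finset.range (M + 1), (-1 : ℝ) ^ m / m.factorial *
              ∫ y, iteratedFDeriv ℝ m newtonKernel x (fun _ => y) * h y| ≤ C * B / (a * ‖x‖ ^ (M + 2)) := by
  -- constants
  obtain ⟨CT, hCT0, hCT⟩ := newtonKernel_taylor_remainder M
  have hKex := exists_norm_iteratedFDeriv_newtonKernel_le
  choose K hK0 hK using hKex
  obtain ⟨KR, hKR0, hKR⟩ := exists_integral_abs_newtonKernel_mul_weight_le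
  set c₄ : ℝ := ∫ y : EuclideanSpace ℝ (Fin 3), ((‖y‖ + 1) ^ 4)⁻¹ with hc₄
  have hc₄0 : 0 ≤ c₄ := integral_nonneg fun y => by positivity
  set S : ℝ := ∑ m ∈ Finset.range (M + 1), K m * 2 ^ (M + 1 - m) / m.factorial with hS
  have hS0 : 0 ≤ S := Finset.sum_nonneg fun m _ => by have := hK0 m; positivity
  refine ⟨(CT + S) * c₄ + 2 ^ (M + 2) * KR, by positivity, fun h hh a B ha hB hb x hax => ?_⟩
  have hx0 : 0 < ‖x‖ := ha.trans_le hax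
  have hx : x ≠ 0 := norm_pos_iff.1 hx0
  set R : ℝ := ‖x‖ / 2 with hR
  have hR0 : 0 < R := by positivity
  -- integrability
  have hIΓ := integrable_newtonKernel_mul_of_apexWeight hh ha hb hx
  have hIm : ∀ m ≤ M + 1, Integrable (fun y => iteratedFDeriv ℝ m newtonKernel x (fun _ => y) * h y) volume :=
    fun m hm => integrable_iteratedFDeriv_newtonKernel_apply_mul hh ha hb x hm
  refine ⟨hIΓ, hIm, ?_⟩
  -- the Taylor polynomial and the remainder
  set T : EuclideanSpace ℝ (Fin 3) → ℝ := fun y => ∑ m ∈ Finset.range (M + 1),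
    (-1 : ℝ) ^ m / m.factorial * iteratedFDeriv ℝ m newtonKernel x (fun _ => y) with hT
  have hIT : Integrable (fun y => T y * h y) volume := by
    have e : (fun y => T y * h y) = fun y => ∑ m ∈ Finset.range (M + 1),
        (-1 : ℝ) ^ m / m.factorial * (iteratedFDeriv ℝ m newtonKernel x (fun _ => y) * h y) := by
      funext y; rw [hT, Finset.sum_mul]; simp only [mul_assoc]
    rw [e]
    exact integrable_finsetSum _ fun m hm =>
      (hIm m (by have := Finset.mem_range.1 hm; omega)).const_mul _
  have hsumint : ∑ m ∈ Finset.range (M + 1), (-1 : ℝ) ^ m / m.factorial *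
      ∫ y, iteratedFDeriv ℝ m newtonKernel x (fun _ => y) * h y = ∫ y, T y * h y := by
    rw [integral_congr_ae (Eventually.of_forall fun y => show T y * h y = ∑ m ∈ Finset.range (M + 1),
        (-1 : ℝ) ^ m / m.factorial * (iteratedFDeriv ℝ m newtonKernel x (fun _ => y) * h y) by
          rw [hT, Finset.sum_mul]; simp only [mul_assoc]),
      integral_finsetSum _ fun m hm => (hIm m (by have := Finset.mem_range.1 hm; omega)).const_mul _]
    refine Finset.sum_congr rfl fun m _ => ?_
    rw [integral_const_mul]
  have hsub : (∫ y, newtonKernel (x - y) * h y) - ∫ y, T y * h y = ∫ y, (newtonKernel (x - y) * h y - T y * h y) :=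
    (integral_sub hIΓ hIT).symm
  rw [hsumint, hsub]
  -- the majorant
  obtain ⟨hIR, hIRle⟩ := hKR a ha x hx
  have hc4 : Continuous fun y : EuclideanSpace ℝ (Fin 3) => ((‖y‖ + a) ^ 4)⁻¹ :=
    ((continuous_norm.add continuous_const).pow 4).inv₀ fun y =>
      (pow_pos (add_pos_of_nonneg_of_pos (norm_nonneg y) ha) 4).ne'
  have hI4 : Integrable (fun y : EuclideanSpace ℝ (Fin 3) => ((‖y‖ + a) ^ 4)⁻¹) volume :=
    integrable_of_norm_le_apexWeight (C := 1) (p := 4) hc4.aestronglyMeasurable ha le_rfl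
      fun y => by rw [norm_inv, norm_pow, Real.norm_of_nonneg (by positivity), one_div]
  set G : EuclideanSpace ℝ (Fin 3) → ℝ := fun y => (CT + S) * B / ‖x‖ ^ (M + 2) * ((‖y‖ + a) ^ 4)⁻¹ +
    2 ^ (M + 2) * B / ‖x‖ ^ (M + 2) * (|newtonKernel (x - y)| * ((‖y‖ + a) ^ 3)⁻¹) with hG
  have hIG : Integrable G volume := (hI4.const_mul _).add (hIR.const_mul _)
  -- pointwise: `|(Γ(x-y) - T y) h y| ≤ G y`
  have hpt : ∀ y, ‖newtonKernel (x - y) * h y - T y * h y‖ ≤ G y := by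
    intro y
    have hρ : 0 < ‖y‖ + a := by positivity
    rw [← sub_mul, norm_mul, Real.norm_eq_abs, Real.norm_eq_abs]
    have hhy := hb y
    have hG1 : 0 ≤ (CT + S) * B / ‖x‖ ^ (M + 2) * ((‖y‖ + a) ^ 4)⁻¹ := by positivity
    have hG2 : 0 ≤ 2 ^ (M + 2) * B / ‖x‖ ^ (M + 2) * (|newtonKernel (x - y)| * ((‖y‖ + a) ^ 3)⁻¹) := by positivity
    by_cases hy : ‖y‖ ≤ R
    · -- near the origin: Taylor
      have h1 := hCT x y hx hy
      have hw := pow_div_norm_add_pow_le (norm_nonneg y) hρ ha.le M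
      calc |newtonKernel (x - y) - T y| * |h y|
          ≤ (CT * ‖y‖ ^ (M + 1) / ‖x‖ ^ (M + 2)) * (B / (‖y‖ + a) ^ (M + 5)) :=
            mul_le_mul h1 hhy (abs_nonneg _) (by positivity)
        _ = CT * B / ‖x‖ ^ (M + 2) * (‖y‖ ^ (M + 1) / (‖y‖ + a) ^ (M + 5)) := by ring
        _ ≤ CT * B / ‖x‖ ^ (M + 2) * ((‖y‖ + a) ^ 4)⁻¹ := mul_le_mul_of_nonneg_left hw (by positivity)
        _ ≤ (CT + S) * B / ‖x‖ ^ (M + 2) * ((‖y‖ + a) ^ 4)⁻¹ := by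
            refine mul_le_mul_of_nonneg_right (div_le_div_of_nonneg_right ?_ (by positivity)) (by positivity)
            nlinarith
        _ ≤ G y := by rw [hG]; linarith
    · -- far from the origin: crude bounds
      rw [not_le] at hy
      have hRρ : R ≤ ‖y‖ + a := by linarith
      -- the kernel term
      have hA : |newtonKernel (x - y)| * |h y| ≤
          2 ^ (M + 2) * B / ‖x‖ ^ (M + 2) * (|newtonKernel (x - y)| * ((‖y‖ + a) ^ 3)⁻¹) := by
        have hw := inv_norm_add_pow_le_far hR0 hRρ M
        have hRpow : (R ^ (M + 2))⁻¹ = 2 ^ (M + 2) / ‖x‖ ^ (M + 2) := by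
          rw [hR, div_pow, inv_div]
        calc |newtonKernel (x - y)| * |h y| ≤ |newtonKernel (x - y)| * (B / (‖y‖ + a) ^ (M + 5)) :=
              mul_le_mul_of_nonneg_left hhy (abs_nonneg _)
          _ = |newtonKernel (x - y)| * B * ((‖y‖ + a) ^ (M + 5))⁻¹ := by rw [div_eq_mul_inv]; ring
          _ ≤ |newtonKernel (x - y)| * B * ((R ^ (M + 2))⁻¹ * ((‖y‖ + a) ^ 3)⁻¹) :=
              mul_le_mul_of_nonneg_left hw (by positivity)
          _ = 2 ^ (M + 2) * B / ‖x‖ ^ (M + 2) * (|newtonKernel (x - y)| * ((‖y‖ + a) ^ 3)⁻¹) := by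
              rw [hRpow]; ring
      -- the polynomial term
      have hBterm : ∀ m ∈ Finset.range (M + 1),
          |(-1 : ℝ) ^ m / m.factorial * iteratedFDeriv ℝ m newtonKernel x (fun _ => y)| * |h y| ≤
            K m * 2 ^ (M + 1 - m) / m.factorial * B / ‖x‖ ^ (M + 2) * ((‖y‖ + a) ^ 4)⁻¹ := by
        intro m hm
        have hmM : m ≤ M := Nat.lt_succ_iff.1 (Finset.mem_range.1 hm)
        obtain ⟨j, hj⟩ := Nat.exists_eq_add_of_le hmM
        have hKm := hK0 m
        have hw : ‖y‖ ^ m / (‖y‖ + a) ^ (M + 5) ≤ (R ^ (j + 1))⁻¹ * ((‖y‖ + a) ^ 4)⁻¹ := by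
          rw [hj]
          exact pow_div_norm_add_pow_le_far (norm_nonneg y) ha.le hR0 hRρ m j
        have h1 := abs_iteratedFDeriv_newtonKernel_apply_le m x y
        have h2 := hK m x hx
        have hfac : (0 : ℝ) < m.factorial := by exact_mod_cast Nat.factorial_pos m
        have hRpow : (R ^ (j + 1))⁻¹ = 2 ^ (M + 1 - m) / ‖x‖ ^ (j + 1) := by
          rw [hR, div_pow, inv_div, show M + 1 - m = j + 1 by omega]
        have hxpow : ‖x‖ ^ (M + 2) = ‖x‖ ^ (m + 1) * ‖x‖ ^ (j + 1) := by
          rw [← pow_add]; congr 1; omega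
        rw [abs_mul, abs_div, abs_pow, abs_neg, abs_one, one_pow, Nat.abs_cast, one_div]
        calc (m.factorial : ℝ)⁻¹ * |iteratedFDeriv ℝ m newtonKernel x (fun _ => y)| * |h y|
            ≤ (m.factorial : ℝ)⁻¹ * (K m / ‖x‖ ^ (m + 1) * ‖y‖ ^ m) * (B / (‖y‖ + a) ^ (M + 5)) := by
              refine mul_le_mul (mul_le_mul_of_nonneg_left (h1.trans (mul_le_mul_of_nonneg_right h2
                (by positivity))) (by positivity)) hhy (abs_nonneg _) (by positivity)
          _ = (m.factorial : ℝ)⁻¹ * K m * B / ‖x‖ ^ (m + 1) * (‖y‖ ^ m / (‖y‖ + a) ^ (M + 5)) := by ring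
          _ ≤ (m.factorial : ℝ)⁻¹ * K m * B / ‖x‖ ^ (m + 1) * ((R ^ (j + 1))⁻¹ * ((‖y‖ + a) ^ 4)⁻¹) :=
              mul_le_mul_of_nonneg_left hw (by positivity)
          _ = K m * 2 ^ (M + 1 - m) / m.factorial * B / ‖x‖ ^ (M + 2) * ((‖y‖ + a) ^ 4)⁻¹ := by
              rw [hRpow, hxpow]
              field_simp
      have hTsum : |T y| * |h y| ≤ S * B / ‖x‖ ^ (M + 2) * ((‖y‖ + a) ^ 4)⁻¹ := by
        calc |T y| * |h y| ≤ (∑ m ∈ Finset.range (M + 1),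
              |(-1 : ℝ) ^ m / m.factorial * iteratedFDeriv ℝ m newtonKernel x (fun _ => y)|) * |h y| :=
              mul_le_mul_of_nonneg_right (Finset.abs_sum_le_sum_abs _ _) (abs_nonneg _)
          _ = ∑ m ∈ Finset.range (M + 1),
                |(-1 : ℝ) ^ m / m.factorial * iteratedFDeriv ℝ m newtonKernel x (fun _ => y)| * |h y| :=
              Finset.sum_mul _ _ _
          _ ≤ ∑ m ∈ Finset.range (M + 1), K m * 2 ^ (M + 1 - m) / m.factorial * B / ‖x‖ ^ (M + 2) *
                ((‖y‖ + a) ^ 4)⁻¹ := Finset.sum_le_sum hBterm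
          _ = S * B / ‖x‖ ^ (M + 2) * ((‖y‖ + a) ^ 4)⁻¹ := by
              rw [hS, Finset.sum_mul, Finset.sum_div, Finset.sum_mul]
      calc |newtonKernel (x - y) - T y| * |h y| ≤ (|newtonKernel (x - y)| + |T y|) * |h y| :=
            mul_le_mul_of_nonneg_right (abs_sub _ _) (abs_nonneg _)
        _ = |newtonKernel (x - y)| * |h y| + |T y| * |h y| := add_mul _ _ _
        _ ≤ 2 ^ (M + 2) * B / ‖x‖ ^ (M + 2) * (|newtonKernel (x - y)| * ((‖y‖ + a) ^ 3)⁻¹) +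
              S * B / ‖x‖ ^ (M + 2) * ((‖y‖ + a) ^ 4)⁻¹ := add_le_add hA hTsum
        _ ≤ G y := by
            rw [hG]
            have : S * B / ‖x‖ ^ (M + 2) * ((‖y‖ + a) ^ 4)⁻¹ ≤ (CT + S) * B / ‖x‖ ^ (M + 2) * ((‖y‖ + a) ^ 4)⁻¹ := by
              refine mul_le_mul_of_nonneg_right (div_le_div_of_nonneg_right ?_ (by positivity)) (by positivity)
              nlinarith
            linarith
  -- integrate the majorant
  have hint4 : ∫ y : EuclideanSpace ℝ (Fin 3), ((‖y‖ + a) ^ 4)⁻¹ = c₄ / a := by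
    rw [integral_inv_norm_add_pow a ha 4, hc₄, pow_succ a 3]
    field_simp
  calc |∫ y, newtonKernel (x - y) * h y - T y * h y| = ‖∫ y, newtonKernel (x - y) * h y - T y * h y‖ :=
        (Real.norm_eq_abs _).symm
    _ ≤ ∫ y, ‖newtonKernel (x - y) * h y - T y * h y‖ := norm_integral_le_integral_norm _
    _ ≤ ∫ y, G y := integral_mono (hIΓ.sub hIT).norm hIG hpt
    _ = (CT + S) * B / ‖x‖ ^ (M + 2) * (c₄ / a) +
          2 ^ (M + 2) * B / ‖x‖ ^ (M + 2) * ∫ y, |newtonKernel (x - y)| * ((‖y‖ + a) ^ 3)⁻¹ := by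
        rw [hG, integral_add (hI4.const_mul _) (hIR.const_mul _), integral_const_mul, integral_const_mul, hint4]
    _ ≤ (CT + S) * B / ‖x‖ ^ (M + 2) * (c₄ / a) + 2 ^ (M + 2) * B / ‖x‖ ^ (M + 2) * (KR * a⁻¹) := by
        refine add_le_add le_rfl (mul_le_mul_of_nonneg_left (hIRle.trans ?_) (by positivity))
        rw [mul_assoc]
        exact mul_le_mul_of_nonneg_left (rpow_quarter_mul_rpow_le ha hax) hKR0
    _ = ((CT + S) * c₄ + 2 ^ (M + 2) * KR) * B / (a * ‖x‖ ^ (M + 2)) := by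
        field_simp

/-! ### Registered sub-goal -/

/-- **Registered helper stub `stub_paintedLadderMultipoleTools`** of `stub_paintedLadderHigher` (crux
stmt-NavierStokesRegularity-11717, line `moment-conditioned-rellich`): the multipole expansion of the Newtonian
potential of a continuous density with `|h(y)| ≤ B/(‖y‖+a)^{M+5}` at points `‖x‖ ≥ a`, to every order `M`, with
absolutely convergent terms and remainder `C_M B/(a‖x‖^{M+2})`. [folklore] -/
theorem stub_paintedLadderMultipoleTools :
    ∀ M : ℕ, ∃ C : ℝ, 0 ≤ C ∧ ∀ (h : EuclideanSpace ℝ (Fin 3) → ℝ), Continuous h → ∀ (a B : ℝ), 0 < a → 0 ≤ B → (∀ y, |h y| ≤ B / (‖y‖ + a) ^ (M + 5)) → ∀ x : EuclideanSpace ℝ (Fin 3), a ≤ ‖x‖ → Integrable (fun y => newtonKernel (x - y) * h y) volume ∧ (∀ m ≤ M + 1, Integrable (fun y => iteratedFDeriv ℝ m newtonKernel x (fun _ => y) * h y) volume) ∧ |(∫ y, newtonKernel (x - y) * h y) - ∑ m ∈ Finset.range (M + 1), (-1 : ℝ) ^ m / m.factorial * ∫ y, iteratedFDeriv ℝ m newtonKernel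 x (fun _ => y) * h y| ≤ C * B / (a * ‖x‖ ^ (M + 2)) :=
  newtonPotential_multipole_expansion

end Summit.NavierStokesRegularity.NavierStokesRegularity.Theorems.RellichScarScarRigidity

end
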